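import Literature.Geometry.Riemannian.PICSphereFactsProofs
import Literature.Geometry.Riemannian.RicciFlowMaximal
import Literature.Geometry.Riemannian.RicciFlowMaximalScaling
import Literature.Geometry.Riemannian.RicciFlowScalarCurvatureProofs
import Literature.Geometry.Riemannian.PinchingEstimates
import Literature.Geometry.Riemannian.CanonicalNeighbourhoods
import Literature.Geometry.Riemannian.HamiltonPCOClassification
import Literature.Geometry.Riemannian.RicciFlowMaximalExistence
import Literature.Geometry.Riemannian.RicciFlowScalarCurvatureHolds
import Literature.Geometry.Riemannian.CurvatureFamilyRegularity
import Literature.Geometry.Riemannian.RicciFlowPICProofs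
import HarnessLib

/-!
# `hamilton_chen_tang_zhu`: status of the discharge, and the decomposition along the printed proof

Companion ("Proofs") file of `Literature/Geometry/Riemannian/HamiltonPIC.lean` for the named fact
`Literature.Geometry.Riemannian.hamilton_chen_tang_zhu` — **Hamilton 1997, Cor. 1.2(a)** (Comm. Anal. Geom. 5,
p. 3): a compact simply connected 4-manifold with a metric of positive isotropic curvature is
diffeomorphic to `S⁴` (surgery argument completed by Chen–Zhu 2006; Chen–Tang–Zhu 2012 for the
statement without the space-form hypothesis). No `hamilton_chen_tang_zhu_holds` exists: the
printed proof is the Ricci flow with surgery on PIC 4-manifolds (Hamilton 1997, §§2–5, 92 pp.;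
Chen–Zhu 2006, 88 pp., on top of Perelman's techniques), a theory absent from Mathlib and from
`Literature/` at this pin. This file records (i) the best reduction currently PROVED in the tree
and (ii) the layers of that theory which have been vendored so far, with a proved "first stage"
assembling them, so that later work can continue from named, typechecked statements.

## (i) The reduction proved so far: `T0 ⇐ A`

Hamilton's Cor. 1.2(a) is read off from his Main Theorem 1.1 (p. 2; Chen–Zhu 2006, Thm. 1.1 /
Cor. 1.2): for simply connected `M` the flow-with-surgery exhibits `M` as a connected sum of
finitely many copies of `S⁴` — the named fact
`A := Literature.Lorentz.hamilton_pic_connectedSum_spheres_four` (`PICSphereFactsProofs.lean`) — and a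
connected sum of 4-spheres is a 4-sphere, Kervaire–Milnor 1963, Lemma 2.1, which is now PROVED
in the tree: `Literature.Topology.FourManifolds.connectedSum_sphere_sphere_holds` (`ConnectedSumSphereIdentity.lean`, via
Palais' disc theorem `PalaisDiscSphere.lean` and uniqueness of open gluings) feeding the
induction `Literature.Topology.FourManifolds.IsConnectedSumOfSpheres.nonempty_diffeomorph_sphere` (`ConnectedSumSpheres.lean`).
Hence (`PICSphereFactsProofs.lean`:
`Literature.Geometry.Riemannian.hamilton_chen_tang_zhu_of_hamilton_pic_connectedSum_spheres_four`, composed below into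
`hamilton_chen_tang_zhu_iff_hamilton_pic_connectedSum_spheres_four`) **the fact is equivalent to
its geometric-analytic half `A`**. Moreover the topological deduction "`π₁ = 1` ⇒ only `S⁴`
summands" has since been carried out in the tree (`HamiltonPICClassification.lean`:
`hamilton_pic_classification_four` — Hamilton's Thm. 1.1 for `π₁ = 1` with its printed list of
pieces `S⁴`, `RP⁴`, `S³ × S¹`, `S³ ×~ S¹` — is equivalent to `A`, using `π₁(RP⁴) ≠ 1`,
`π₁` of mapping tori and of connected sums, all proved), so the remaining debt is the Ricci
flow with surgery producing that decomposition (Chen–Zhu 2006, Thm. 1.1 / Thm. 5.6).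

## (ii) Layers of the proof of `A` vendored so far (all in `Literature/Geometry/Riemannian/`)

Hamilton's programme (1997, pp. 3–4; Chen–Zhu 2006, pp. 2–3): run the Ricci flow from the PIC
metric; PIC and the pinching estimates are preserved (§2 = Section B); at the finite singular
time the high-curvature regions are necks `S³ × B¹` (or quotients, excluded when `π₁ = 1` by
Thm. C3.1) or caps, or whole components of positive curvature operator, which are `S⁴`/`RP⁴`
(Hamilton 1986) and are discarded (§3 = C); surgery cuts the necks and glues caps preserving PIC
and pinching (§4 = D); finitely many surgeries until extinction (§5 = E, completed by Chen–Zhu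
2006, Thm. 1.1); the manifold is recovered from the discarded pieces by connected sums.

| node | content | Lean | status |
|---|---|---|---|
| RF0 | Ricci flow `∂g/∂t = -2Ric`, smooth families | `IsRicciFlow`, `IsContMDiffFamilyOn` (`RicciFlow.lean`) | definitions |
| RF0' | homothety, parabolic rescaling, Einstein solutions | `RicciFlowScaling.lean` | proved |
| RF1 | short-time existence, uniqueness (Hamilton 1982, Thms. 4.2, 5.1, 14.1) | `ricciFlow_shortTime_existence`, `ricciFlow_uniqueness` | named facts |
| RF2 | PIC preserved (Hamilton 1997, Thm. B1.2) | `ricciFlow_preserves_positiveIsotropicCurvature` | named fact |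
| RF3 | pinching (Hamilton 1997, Thms. B1.1, B1.2, B2.3; Chen–Zhu 2006, Lemma 2.1, (2.1)–(2.4)) | `hamilton_chenZhu_pinching`, `ricciFlow_preserves_twoSmallestEigenvaluesSum_ge` over `blockA/B/C` (`CurvatureDecomposition.lean`, `PinchingEstimates.lean`) | named facts over real definitions |
| RF3' | PIC iff `a₁+a₂>0 ∧ c₁+c₂>0` (Hamilton 1997, Lemma A2.1, §1.2 p. 5) | `hamilton_positiveIsotropicCurvature_iff_blocks` | named fact; PCO ⇒ PIC proved from it |
| RF6a | `R ≥ α/(1-(2α/n)t)`, `T ≤ n/(2α)` (Topping Thm. 3.2.1, Cor. 3.2.4; Hamilton 1982, Cor. 7.5–7.6), PIC ⇒ `R ≥ α > 0` | `RicciFlowScalarCurvature.lean`, `RicciFlowScalarCurvatureProofs.lean` | named facts; finite singular time for PIC proved from them; PIC ⇒ `R > 0` pointwise PROVED (six-frame argument), the uniform bound reduced to the regularity fact `contMDiff_scalarCurvatureWith` (O'Neill Def. 3.53) |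
| RF6b | maximal solution, curvature blow-up (Hamilton 1982, Thm. 14.1; Topping Thm. 5.3.1), metric equivalence (Topping Lemma 5.3.2), parabolic rescaling of maximal flows ("we may assume `T₀ > 1`", Chen–Zhu p. 26) | `RicciFlowMaximal.lean`, `RicciFlowMaximalScaling.lean` | named facts; Lemma 5.3.2, CZ06 p. 19 first paragraph and the rescaling PROVED |
| RF7 | compact PCO 4-manifolds are `S⁴`/`RP⁴` (Hamilton 1986, Thm. 1.1) | `hamilton_positiveCurvatureOperator_classification_four` (`HamiltonPCOClassification.lean`; simply connected case `…_sphere_four`, `CurvatureOperator.lean`, derived from it) | named fact in printed generality over `IsRealProjectiveSpace`; PCO components are `IsHamiltonPICPiece`s PROVED |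
| RF4₀ | round cylinders, `ε`-necks, strong/evolving `ε`-necks, `ε`-caps, distance balls (Chen–Zhu 2006, §2 p. 4, Thm. 3.8 (a), §4 p. 24, §5 p. 26; Hamilton 1997, §C2) | `Necks.lean`, `EvolvingNecks.lean`, `CanonicalNeighbourhoods.lean`, `RiemannianDistance.lean` | real definitions, **C⁰ closeness only** (weaker than the sources' `C^{[ε⁻¹]}`; volume bounds omitted), model cases proved |
| RF4₁ | faithful `C^{[ε⁻¹]}` `ε`-necks and strong `ε`-necks (Chen–Zhu 2006, §2 p. 4, §5 p. 26 (a); closeness = Hamilton 1997, §3.2 (C2), p. 31, (A), (B), `k = [ε⁻¹]`) in the conformal annulus model `(A(L), c|x|⁻²δ) ≅ (S^m × (-L, L), c g_round + dz²)` | `IsCkEpsNeck`, `IsCkStrongEpsNeck`, `IsCkCloseOn`, `cylCovDerivIter` (`CkNecks.lean`) | real definitions; `D̄ḡ = 0` and the model case proved; `δ`-necks (`IsCkEpsNeck` with `ε = δ`) are now statable; bridges to the C⁰ notions and `C^k` caps / canonical neighbourhoods to come |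
| RF4 | canonical neighbourhoods at the first singular time: the smooth maximal solution satisfies the a priori assumptions (Chen–Zhu 2006, §5 p. 26, from Lemma 2.1, Thm. 4.1, §3); Perelman's no local collapsing theorem I (2002, Thm. 4.1; Chen–Zhu p. 19) | `chenZhu_aprioriAssumptions_smoothSolution`, `perelman_noLocalCollapsing` over `IsKappaNoncollapsed`, Riemannian volume (`CanonicalNeighbourhoods.lean`, `Lorentzian/Volume.lean`) | named facts (π₁ = 1, conclusion in the weakened C⁰ neck vocabulary, otherwise as printed incl. volume bounds); Thm. 4.1 itself and the ancient κ-solutions of §3 (`C^k`-closeness, pointed convergence) not yet statable |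
| RF5 | surgery preserving PIC and pinching (Hamilton 1997, §4 = D; Chen–Zhu 2006, §5, Lemma 5.2, Lemma 5.3, Prop. 5.4, Lemma 5.5) | — (δ-necks are statable, `CkNecks.lean`; needs the δ-cutoff surgery of Riemannian 4-manifolds along δ-necks and the standard capped cylinder / standard solution, Chen–Zhu §5 p. 29, App. A) | not yet statable |
| RF6 | Ricci flow with surgery: discreteness of surgery times, extinction, reconstruction (Chen–Zhu 2006, Def. 5.1, Thm. 5.6 ⇒ Thm. 1.1 (i)–(iv) ⇒ Cor. 1.2) | — (the TOP of the analytic debt: its conclusion for `π₁ = 1` *is* `hamilton_pic_classification_four`) | not yet statable below its conclusion |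
| A | simply connected compact PIC 4-manifold is a connected sum of `S⁴`'s ⇔ (for `π₁ = 1`) Hamilton's Thm. 1.1 with printed pieces | `Literature.Geometry.Riemannian.hamilton_pic_connectedSum_spheres_four` ⇔ `hamilton_pic_classification_four` (`HamiltonPICClassification.lean`) | named facts, equivalence PROVED (the remaining debt) |
| B | `S⁴ # S⁴ ≅ S⁴` (Kervaire–Milnor 1963, Lemma 2.1) | `Literature.Topology.FourManifolds.connectedSum_sphere_sphere_holds` | PROVED |
| T0 | Cor. 1.2(a) | `hamilton_chen_tang_zhu` | ⇔ A (`PICSphereFactsProofs.lean`, this file) |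

`hamilton_programme_firstStage` below chains RF1/RF6b, RF6a, RF2 and RF3 on a simply connected
closed PIC 4-manifold: the maximal Ricci flow from the PIC metric exists, lives for a finite time
`T ≤ 2/α`, its curvature blows up as `t ↑ T`, and PIC and Hamilton's pinching hold up to `T` —
exactly the situation at the start of Hamilton 1997, §E / Chen–Zhu 2006, §4, where the neck and
surgery analysis (RF4–RF6) takes over. `hamilton_programme_secondStage` adds RF4 and the
normalisation of RF6b: after a parabolic rescaling of the initial metric the maximal flow has
`T > 1` (proved, `RicciFlowMaximalScaling.lean`), and — granting the named fact
`chenZhu_aprioriAssumptions_smoothSolution` (Chen–Zhu 2006, §5, p. 26) — every point of scalar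
curvature `≥ r(t)⁻²` has a canonical neighbourhood (strong `ε`-neck, `ε`-cap, or compact
component of positive curvature operator, the latter being `S⁴`/`RP⁴` pieces by RF7): the exact
input of the first surgery (Chen–Zhu 2006, §5, pp. 26–27).

## References

* R. S. Hamilton, *Four-manifolds with positive isotropic curvature*, Comm. Anal. Geom. 5 (1997)
  1–92: Thm. 1.1 (p. 2), Cor. 1.2(a) (p. 3), outline pp. 3–4, §1.2, §§2–5. [Hamilton1997]
* B.-L. Chen, X.-P. Zhu, *Ricci flow with surgery on four-manifolds with positive isotropic
  curvature*, J. Differential Geom. 74 (2006) 177–264 (arXiv:math/0504478): Thm. 1.1, Cor. 1.2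
  (p. 3), §2 Lemma 2.1 (p. 4), §4 (p. 19). [ChenZhu2006]
* B.-L. Chen, S.-H. Tang, X.-P. Zhu, J. Differential Geom. 91 (2012) 41–80, §1. [ChenTangZhu2012]
* R. S. Hamilton, J. Differential Geom. 17 (1982) 255–306 (Thms. 4.2, 5.1, 14.1, Cor. 7.5–7.6);
  J. Differential Geom. 24 (1986) 153–179 (Thm. 1.1). [Hamilton1982] [Hamilton1986]
* P. Topping, *Lectures on the Ricci flow*, LMS LNS 325 (2006), §§1.2, 3.2, 5.2–5.3. [Topping2006]
* M. Kervaire, J. Milnor, Ann. of Math. 77 (1963), §2, Lemma 2.1. [KervaireMilnor1963]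
* G. Perelman, *The entropy formula for the Ricci flow and its geometric applications*,
  arXiv:math/0211159 (2002), §4, Thm. 4.1, Def. 4.2 (no local collapsing). [Perelman2002]
* R. S. Hamilton, J. Differential Geom. 24 (1986), Thm. 1.1 (positive curvature operator).
  [Hamilton1986]
-/

noncomputable section

open Set
open scoped Manifold ContDiff

namespace Literature.Geometry.Riemannian

open Lorentzian

/-- **The remaining debt, exactly** (for this vending). `hamilton_chen_tang_zhu` (Hamilton 1997,
Cor. 1.2(a)) is equivalent to Hamilton's Thm. 1.1 in the simply connected, connected-sum form
`Literature.Geometry.Riemannian.hamilton_pic_connectedSum_spheres_four` (a closed simply connected PIC 4-manifold is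
a connected sum of finitely many `S⁴`'s): the topological half `S⁴ # S⁴ ≅ S⁴` (Kervaire–Milnor
1963, Lemma 2.1) is PROVED in the tree (`Literature.Topology.FourManifolds.connectedSum_sphere_sphere_holds`), and the
reduction `Literature.Geometry.Riemannian.hamilton_chen_tang_zhu_of_hamilton_pic_connectedSum_spheres_four` with
its converse are in `PICSphereFactsProofs.lean`; this merely composes them for the `Riemannian`
vending. [cite: Hamilton1997, Thm. 1.1 (p. 2) and Cor. 1.2(a) (p. 3)] -/
theorem hamilton_chen_tang_zhu_iff_hamilton_pic_connectedSum_spheres_four :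
    hamilton_chen_tang_zhu ↔ Literature.Geometry.Riemannian.hamilton_pic_connectedSum_spheres_four :=
  Literature.Geometry.Riemannian.hamilton_pic_sphere_four_iff_hamilton_chen_tang_zhu.symm.trans
    Literature.Geometry.Riemannian.hamilton_pic_sphere_four_iff_hamilton_pic_connectedSum_spheres_four

/-- **First stage of Hamilton's programme, assembled from the vendored layers** (Hamilton 1997,
pp. 3–4 and §2; Chen–Zhu 2006, §4, p. 19: "let `g_ij(x,t)`, `t ∈ [0,T)`, be a maximal solution to
the Ricci flow with `g_ij(x,0) = g_ij(x)` … the maximal time `T` must be finite and the curvature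
tensor becomes unbounded as `t → T`", together with the preserved PIC (Thm. B1.2) and pinching
(Chen–Zhu Lemma 2.1) that the subsequent singularity analysis uses). From the named facts
`ricciFlow_maximal_existence`, `ricciFlow_singularTime_le`,
`exists_pos_le_scalarCurvature_of_hasPositiveIsotropicCurvature`, `ricciFlow_curvature_blowup`
(`RicciFlowMaximal.lean`, `RicciFlowScalarCurvature.lean`),
`ricciFlow_preserves_positiveIsotropicCurvature` (`RicciFlow.lean`) and `hamilton_chenZhu_pinching`
(`PinchingEstimates.lean`): on a nonempty closed smooth 4-manifold with a `C^∞` Riemannian PIC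
metric `g₀` there is a maximal Ricci flow `(g, cov)` on `[0, T)` from `g₀` with (a) `T ≤ 2/α` for
a positive lower bound `α` of the initial scalar curvature, (b) curvature unbounded as `t ↑ T`,
(c) every `g t` of positive isotropic curvature, (d) Hamilton's pinching (2.1)–(2.3) in every
orthonormal frame at all points and times, with constants depending only on `g₀`.
[cite: ChenZhu2006, §4, p. 19] [cite: Hamilton1997, §1, pp. 3–4] -/
theorem hamilton_programme_firstStage
    (h₁ : ricciFlow_maximal_existence.{0, 0, 0}) (h₂ : ricciFlow_singularTime_le.{0, 0, 0})
    (h₃ : exists_pos_le_scalarCurvature_of_hasPositiveIsotropicCurvature.{0})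
    (h₄ : ricciFlow_curvature_blowup.{0, 0, 0})
    (h₅ : ricciFlow_preserves_positiveIsotropicCurvature.{0})
    (h₆ : hamilton_chenZhu_pinching.{0})
    (M : Type) [TopologicalSpace M] [T2Space M] [SecondCountableTopology M] [CompactSpace M]
    [Nonempty M] [ChartedSpace (EuclideanSpace ℝ (Fin 4)) M] [IsManifold (𝓡 4) ∞ M]
    (g₀ : PseudoRiemannianMetric (𝓡 4) ∞ (EuclideanSpace ℝ (Fin 4))
      (TangentSpace (𝓡 4) : M → Type _))
    (hg₀ : g₀.IsRiemannian) (hpic : g₀.HasPositiveIsotropicCurvature) :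
    ∃ (T : ℝ) (g : ℝ → PseudoRiemannianMetric (𝓡 4) ∞ (EuclideanSpace ℝ (Fin 4))
        (TangentSpace (𝓡 4) : M → Type _))
      (cov : ℝ → CovariantDerivative (𝓡 4) (EuclideanSpace ℝ (Fin 4))
        (TangentSpace (𝓡 4) : M → Type _)),
      IsMaximalRicciFlow g cov T ∧ g 0 = g₀ ∧
      (∃ α : ℝ, 0 < α ∧ (∀ x : M, α ≤ g₀.scalarCurvatureWith (cov 0) x) ∧ T ≤ 2 / α) ∧
      (∀ C : ℝ, ∃ t₀ ∈ Ico 0 T, ∀ t ∈ Ico t₀ T, ¬ CurvatureBoundedBy (g t) (cov t) C) ∧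
      (∀ t ∈ Ico 0 T, (g t).HasPositiveIsotropicCurvature) ∧
      ∃ ρ Λ P : ℝ, 0 < ρ ∧ 0 < Λ ∧ 0 < P ∧
        ∀ t ∈ Ico 0 T, ∀ (x : M) (e : Fin 4 → TangentSpace (𝓡 4) x),
          (g t).IsOrthonormalFrame x e →
            Matrix.PinchedBy ((g t).blockA (cov t) x e) ((g t).blockB (cov t) x e)
                ((g t).blockC (cov t) x e) ρ Λ ∧
              Matrix.ImprovedPinchingAt ((g t).blockA (cov t) x e) ((g t).blockB (cov t) x e)
                ((g t).blockC (cov t) x e) ρ Λ P t := by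
  obtain ⟨T, g, cov, hmax, h0, hα, hblow⟩ :=
    exists_isMaximalRicciFlow_of_hasPositiveIsotropicCurvature h₁ h₂ h₃ h₄ M g₀ hg₀ hpic
  have h0' : (g 0).HasPositiveIsotropicCurvature := h0 ▸ hpic
  have hPIC : ∀ t ∈ Ico 0 T, (g t).HasPositiveIsotropicCurvature :=
    h₅ M T g cov hmax.isRicciFlow hmax.isRiemannian h0'
  obtain ⟨ρ, Λ, P, hρ, hΛ, hP, hpinch⟩ := h₆ M g₀ hg₀ hpic
  exact ⟨T, g, cov, hmax, h0, hα, hblow, hPIC, ρ, Λ, P, hρ, hΛ, hP,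
    hpinch T g cov hmax.isRicciFlow hmax.isRiemannian h0⟩

/-- **Second stage of Hamilton's programme: the state at the first singular time, with canonical
neighbourhoods** (Chen–Zhu 2006, §5, pp. 26–27: "the Ricci flow with it as initial data has a
maximal solution `g_ij(x,t)` on `[0,T₀)` with `T₀ < +∞`. Without loss of generality, after a
scaling on the initial metric, we may assume `T₀ > 1`. It follows from Lemma 2.1 and Theorem 4.1
that the a priori assumptions above hold for the smooth solution on `[0, T₀)`" — where the
surgery procedure starts). Assembled from the named facts of the first stage
(`ricciFlow_maximal_existence`, `ricciFlow_singularTime_le`, `ricciFlow_curvature_blowup`,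
`ricciFlow_preserves_positiveIsotropicCurvature`, `hamilton_chenZhu_pinching`), the regularity
fact `contMDiff_scalarCurvatureWith` (O'Neill Def. 3.53, from which the PIC scalar-curvature
bound is now proved, `RicciFlowScalarCurvatureProofs.lean`), the PROVED parabolic rescaling of
maximal flows (`RicciFlowMaximalScaling.lean`) and the named fact
`chenZhu_aprioriAssumptions_smoothSolution` and Perelman's no local collapsing theorem I
`perelman_noLocalCollapsing` (`CanonicalNeighbourhoods.lean`): with a universal
`η > 0` and a smallness threshold `ε₀ > 0`, for every accuracy `0 < ε ≤ ε₀` there are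
`C₁, C₂ > 0` such that on every closed simply connected smooth 4-manifold (with its Borel
σ-algebra, for the volumes) with a `C^∞` Riemannian PIC metric `g₀` there are `λ > 0` and a maximal Ricci flow `(g, cov)` on `[0, T)`,
`T > 1`, with `g 0 = λ • g₀`, whose curvature blows up as `t ↑ T`, all of whose metrics have
positive isotropic curvature and satisfy Hamilton's pinching with constants depending only on
the initial metric, which is `κ`-noncollapsed on all scales `< √T` for some `κ > 0`, and a
positive non-increasing `r` on `[0, ∞)` such that every `(x, t)` with
`R(x, t) ≥ r(t)⁻²` has a canonical neighbourhood with accuracy `ε` and constants `C₁, C₂, η`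
(`HasCanonicalNeighbourhood`, C⁰ form). [cite: ChenZhu2006, §5, pp. 26–27] [cite: Hamilton1997, §1, pp. 3–4] -/
theorem hamilton_programme_secondStage
    (h₁ : ricciFlow_maximal_existence.{0, 0, 0}) (h₂ : ricciFlow_singularTime_le.{0, 0, 0})
    (h₃ : contMDiff_scalarCurvatureWith.{0, 0, 0})
    (h₄ : ricciFlow_curvature_blowup.{0, 0, 0})
    (h₅ : ricciFlow_preserves_positiveIsotropicCurvature.{0})
    (h₆ : hamilton_chenZhu_pinching.{0})
    (h₇ : chenZhu_aprioriAssumptions_smoothSolution) (h₈ : perelman_noLocalCollapsing.{0, 0, 0}) :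
    ∃ η : ℝ, 0 < η ∧ ∃ ε₀ : ℝ, 0 < ε₀ ∧ ∀ ε : ℝ, 0 < ε → ε ≤ ε₀ → ∃ C₁ C₂ : ℝ, 0 < C₁ ∧ 0 < C₂ ∧
      ∀ (M : Type) [TopologicalSpace M] [T2Space M] [SecondCountableTopology M] [CompactSpace M]
        [ChartedSpace (EuclideanSpace ℝ (Fin 4)) M] [IsManifold (𝓡 4) ∞ M] [SimplyConnectedSpace M]
        [MeasurableSpace M] [BorelSpace M]
        (g₀ : PseudoRiemannianMetric (𝓡 4) ∞ (EuclideanSpace ℝ (Fin 4))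
          (TangentSpace (𝓡 4) : M → Type _)),
        g₀.IsRiemannian → g₀.HasPositiveIsotropicCurvature →
        ∃ (c : ℝ) (hc : 0 < c) (T : ℝ)
          (g : ℝ → PseudoRiemannianMetric (𝓡 4) ∞ (EuclideanSpace ℝ (Fin 4))
            (TangentSpace (𝓡 4) : M → Type _))
          (cov : ℝ → CovariantDerivative (𝓡 4) (EuclideanSpace ℝ (Fin 4))
            (TangentSpace (𝓡 4) : M → Type _)),
          IsMaximalRicciFlow g cov T ∧ 1 < T ∧ g 0 = g₀.constSmul c hc.ne' ∧
          (∀ C : ℝ, ∃ t₀ ∈ Ico 0 T, ∀ t ∈ Ico t₀ T, ¬ CurvatureBoundedBy (g t) (cov t) C) ∧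
          (∀ t ∈ Ico 0 T, (g t).HasPositiveIsotropicCurvature) ∧
          (∃ ρ Λ P : ℝ, 0 < ρ ∧ 0 < Λ ∧ 0 < P ∧
            ∀ t ∈ Ico 0 T, ∀ (x : M) (e : Fin 4 → TangentSpace (𝓡 4) x),
              (g t).IsOrthonormalFrame x e →
                Matrix.PinchedBy ((g t).blockA (cov t) x e) ((g t).blockB (cov t) x e)
                    ((g t).blockC (cov t) x e) ρ Λ ∧
                  Matrix.ImprovedPinchingAt ((g t).blockA (cov t) x e) ((g t).blockB (cov t) x e)
                    ((g t).blockC (cov t) x e) ρ Λ P t) ∧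
          (∃ κ : ℝ, 0 < κ ∧ ∀ r₀ : ℝ, 0 < r₀ → r₀ < Real.sqrt T →
            IsKappaNoncollapsed g cov (Ico 0 T) κ r₀) ∧
          ∃ r : ℝ → ℝ, (∀ t ∈ Ici (0 : ℝ), 0 < r t) ∧ AntitoneOn r (Ici 0) ∧
            ∀ t ∈ Ico 0 T, ∀ x : M,
              (r t)⁻¹ ^ 2 ≤ (g t).scalarCurvatureWith (cov t) x →
                HasCanonicalNeighbourhood g cov (Ico 0 T) x t ε C₁ C₂ η := by
  obtain ⟨η, hη, ε₀, hε₀, H⟩ := h₇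
  refine ⟨η, hη, ε₀, hε₀, fun ε hε hεε₀ ↦ ?_⟩
  obtain ⟨C₁, C₂, hC₁, hC₂, Hcan⟩ := H ε hε hεε₀
  refine ⟨C₁, C₂, hC₁, hC₂, fun M _ _ _ _ _ _ _ _ _ g₀ hg₀ hpic ↦ ?_⟩
  -- the PIC scalar-curvature bound, now from the regularity fact
  have h₃' : exists_pos_le_scalarCurvature_of_hasPositiveIsotropicCurvature.{0} :=
    exists_pos_le_scalarCurvature_of_hasPositiveIsotropicCurvature_of_contMDiff h₃
  -- the maximal solution from `g₀` (finite singular time) …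
  obtain ⟨T₀, g₁, cov₁, hmax₁, h0₁, -, -⟩ :=
    exists_isMaximalRicciFlow_of_hasPositiveIsotropicCurvature h₁ h₂ h₃' h₄ M g₀ hg₀ hpic
  -- … rescaled so that `T > 1`
  obtain ⟨c, hc, g, cov, T, hmax, hT, h0, -, -⟩ :=
    exists_isMaximalRicciFlow_one_lt_of_isMaximalRicciFlow hmax₁
  have h0' : g 0 = g₀.constSmul c hc.ne' := by rw [h0, h0₁]
  have hg₀' : (g₀.constSmul c hc.ne').IsRiemannian := hg₀.constSmul hc
  have hpic' : (g₀.constSmul c hc.ne').HasPositiveIsotropicCurvature := hpic.constSmul hc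
  have hpic0 : (g 0).HasPositiveIsotropicCurvature := h0' ▸ hpic'
  refine ⟨c, hc, T, g, cov, hmax, hT, h0', h₄ (𝓡 4) M T g cov hmax,
    h₅ M T g cov hmax.isRicciFlow hmax.isRiemannian hpic0, ?_,
    h₈ (𝓡 4) M T hmax.pos g cov hmax.isRicciFlow hmax.isRiemannian, ?_⟩
  · obtain ⟨ρ, Λ, P, hρ, hΛ, hP, hpinch⟩ := h₆ M (g₀.constSmul c hc.ne') hg₀' hpic'
    exact ⟨ρ, Λ, P, hρ, hΛ, hP, hpinch T g cov hmax.isRicciFlow hmax.isRiemannian h0'⟩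
  · exact Hcan M g cov T hmax hT hpic0

/-! ### Status update (appended 2026-08-14): three inputs of the first two stages are now
theorems

* RF3' — Hamilton's Lemma A2.1 `hamilton_positiveIsotropicCurvature_iff_blocks` is PROVED
  (`CurvatureDecompositionProofs.lean`, `hamilton_positiveIsotropicCurvature_iff_blocks_holds`);
* RF6a — the regularity fact `contMDiff_scalarCurvatureWith` is PROVED
  (`Lorentzian/CurvatureRegularity.lean`, `RicciFlowScalarCurvatureHolds.lean`:
  `contMDiff_scalarCurvatureWith_holds`), hence so is the PIC scalar-curvature bound
  `exists_pos_le_scalarCurvature_of_hasPositiveIsotropicCurvature_holds`;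
* RF6b — `ricciFlow_maximal_existence` is DERIVED from short-time existence and uniqueness
  (`RicciFlowMaximalExistence.lean`, Topping 2006, p. 46).

The primed stages below take the reduced list of hypotheses accordingly: short-time existence
and uniqueness (Hamilton 1982, Thms. 4.2, 5.1), the singular-time bound (Topping Cor. 3.2.4),
curvature blow-up (Topping Thm. 5.3.1), preservation of PIC (Hamilton 1997, Thm. B1.2), pinching
(Chen–Zhu 2006, Lemma 2.1), and for the second stage the a priori assumptions and no local
collapsing. -/

/-- **First stage of Hamilton's programme, reduced hypotheses** (Chen–Zhu 2006, §4, p. 19;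
Hamilton 1997, pp. 3–4): as `hamilton_programme_firstStage`, with the maximal solution now
obtained from short-time existence and uniqueness
(`ricciFlow_maximal_existence_of_shortTime_of_uniqueness`) and the PIC scalar-curvature bound
proved (`exists_pos_le_scalarCurvature_of_hasPositiveIsotropicCurvature_holds`).
[cite: ChenZhu2006, §4, p. 19] [cite: Hamilton1997, §1, pp. 3–4] -/
theorem hamilton_programme_firstStage'
    (hST : ricciFlow_shortTime_existence.{0, 0, 0}) (hU : ricciFlow_uniqueness.{0, 0, 0})
    (h₂ : ricciFlow_singularTime_le.{0, 0, 0}) (h₄ : ricciFlow_curvature_blowup.{0, 0, 0})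
    (h₅ : ricciFlow_preserves_positiveIsotropicCurvature.{0})
    (h₆ : hamilton_chenZhu_pinching.{0})
    (M : Type) [TopologicalSpace M] [T2Space M] [SecondCountableTopology M] [CompactSpace M]
    [Nonempty M] [ChartedSpace (EuclideanSpace ℝ (Fin 4)) M] [IsManifold (𝓡 4) ∞ M]
    (g₀ : PseudoRiemannianMetric (𝓡 4) ∞ (EuclideanSpace ℝ (Fin 4))
      (TangentSpace (𝓡 4) : M → Type _))
    (hg₀ : g₀.IsRiemannian) (hpic : g₀.HasPositiveIsotropicCurvature) :
    ∃ (T : ℝ) (g : ℝ → PseudoRiemannianMetric (𝓡 4) ∞ (EuclideanSpace ℝ (Fin 4))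
        (TangentSpace (𝓡 4) : M → Type _))
      (cov : ℝ → CovariantDerivative (𝓡 4) (EuclideanSpace ℝ (Fin 4))
        (TangentSpace (𝓡 4) : M → Type _)),
      IsMaximalRicciFlow g cov T ∧ g 0 = g₀ ∧
      (∃ α : ℝ, 0 < α ∧ (∀ x : M, α ≤ g₀.scalarCurvatureWith (cov 0) x) ∧ T ≤ 2 / α) ∧
      (∀ C : ℝ, ∃ t₀ ∈ Ico 0 T, ∀ t ∈ Ico t₀ T, ¬ CurvatureBoundedBy (g t) (cov t) C) ∧
      (∀ t ∈ Ico 0 T, (g t).HasPositiveIsotropicCurvature) ∧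
      ∃ ρ Λ P : ℝ, 0 < ρ ∧ 0 < Λ ∧ 0 < P ∧
        ∀ t ∈ Ico 0 T, ∀ (x : M) (e : Fin 4 → TangentSpace (𝓡 4) x),
          (g t).IsOrthonormalFrame x e →
            Matrix.PinchedBy ((g t).blockA (cov t) x e) ((g t).blockB (cov t) x e)
                ((g t).blockC (cov t) x e) ρ Λ ∧
              Matrix.ImprovedPinchingAt ((g t).blockA (cov t) x e) ((g t).blockB (cov t) x e)
                ((g t).blockC (cov t) x e) ρ Λ P t :=
  hamilton_programme_firstStage (ricciFlow_maximal_existence_of_shortTime_of_uniqueness hST hU) h₂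
    exists_pos_le_scalarCurvature_of_hasPositiveIsotropicCurvature_holds h₄ h₅ h₆ M g₀ hg₀ hpic

/-- **Second stage of Hamilton's programme, reduced hypotheses** (Chen–Zhu 2006, §5,
pp. 26–27): as `hamilton_programme_secondStage`, with the maximal solution from short-time
existence and uniqueness and the regularity of the scalar curvature proved
(`contMDiff_scalarCurvatureWith_holds`). [cite: ChenZhu2006, §5, pp. 26–27] [cite: Hamilton1997, §1, pp. 3–4] -/
theorem hamilton_programme_secondStage'
    (hST : ricciFlow_shortTime_existence.{0, 0, 0}) (hU : ricciFlow_uniqueness.{0, 0, 0})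
    (h₂ : ricciFlow_singularTime_le.{0, 0, 0}) (h₄ : ricciFlow_curvature_blowup.{0, 0, 0})
    (h₅ : ricciFlow_preserves_positiveIsotropicCurvature.{0})
    (h₆ : hamilton_chenZhu_pinching.{0})
    (h₇ : chenZhu_aprioriAssumptions_smoothSolution) (h₈ : perelman_noLocalCollapsing.{0, 0, 0}) :
    ∃ η : ℝ, 0 < η ∧ ∃ ε₀ : ℝ, 0 < ε₀ ∧ ∀ ε : ℝ, 0 < ε → ε ≤ ε₀ → ∃ C₁ C₂ : ℝ, 0 < C₁ ∧ 0 < C₂ ∧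
      ∀ (M : Type) [TopologicalSpace M] [T2Space M] [SecondCountableTopology M] [CompactSpace M]
        [ChartedSpace (EuclideanSpace ℝ (Fin 4)) M] [IsManifold (𝓡 4) ∞ M] [SimplyConnectedSpace M]
        [MeasurableSpace M] [BorelSpace M]
        (g₀ : PseudoRiemannianMetric (𝓡 4) ∞ (EuclideanSpace ℝ (Fin 4))
          (TangentSpace (𝓡 4) : M → Type _)),
        g₀.IsRiemannian → g₀.HasPositiveIsotropicCurvature →
        ∃ (c : ℝ) (hc : 0 < c) (T : ℝ)
          (g : ℝ → PseudoRiemannianMetric (𝓡 4) ∞ (EuclideanSpace ℝ (Fin 4))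
            (TangentSpace (𝓡 4) : M → Type _))
          (cov : ℝ → CovariantDerivative (𝓡 4) (EuclideanSpace ℝ (Fin 4))
            (TangentSpace (𝓡 4) : M → Type _)),
          IsMaximalRicciFlow g cov T ∧ 1 < T ∧ g 0 = g₀.constSmul c hc.ne' ∧
          (∀ C : ℝ, ∃ t₀ ∈ Ico 0 T, ∀ t ∈ Ico t₀ T, ¬ CurvatureBoundedBy (g t) (cov t) C) ∧
          (∀ t ∈ Ico 0 T, (g t).HasPositiveIsotropicCurvature) ∧
          (∃ ρ Λ P : ℝ, 0 < ρ ∧ 0 < Λ ∧ 0 < P ∧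
            ∀ t ∈ Ico 0 T, ∀ (x : M) (e : Fin 4 → TangentSpace (𝓡 4) x),
              (g t).IsOrthonormalFrame x e →
                Matrix.PinchedBy ((g t).blockA (cov t) x e) ((g t).blockB (cov t) x e)
                    ((g t).blockC (cov t) x e) ρ Λ ∧
                  Matrix.ImprovedPinchingAt ((g t).blockA (cov t) x e) ((g t).blockB (cov t) x e)
                    ((g t).blockC (cov t) x e) ρ Λ P t) ∧
          (∃ κ : ℝ, 0 < κ ∧ ∀ r₀ : ℝ, 0 < r₀ → r₀ < Real.sqrt T →
            IsKappaNoncollapsed g cov (Ico 0 T) κ r₀) ∧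
          ∃ r : ℝ → ℝ, (∀ t ∈ Ici (0 : ℝ), 0 < r t) ∧ AntitoneOn r (Ici 0) ∧
            ∀ t ∈ Ico 0 T, ∀ x : M,
              (r t)⁻¹ ^ 2 ≤ (g t).scalarCurvatureWith (cov t) x →
                HasCanonicalNeighbourhood g cov (Ico 0 T) x t ε C₁ C₂ η :=
  hamilton_programme_secondStage (ricciFlow_maximal_existence_of_shortTime_of_uniqueness hST hU) h₂
    contMDiff_scalarCurvatureWith_holds h₄ h₅ h₆ h₇ h₈

/-! ### Status update (appended 2026-08-15): four more inputs reduced or proved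

Since the previous update the tree has acquired (other files of the topic):

* the regularity fact `continuousOn_scalarCurvatureWith_family` is PROVED
  (`CurvatureFamilyRegularity.lean`: the scalar curvature of a smooth family is jointly `C^∞`),
  and with it the a priori assumptions of the smooth solution follow from **Chen–Zhu 2006,
  Thm. 4.1** (`chenZhu_canonicalNeighbourhoodTheorem`), Perelman's no local collapsing, Lemma 2.1
  and the preservation of PIC (`chenZhu_aprioriAssumptions_smoothSolution_of_canonicalNeighbourhoodTheorem`,
  `CanonicalNeighbourhoodTheorem.lean`);
* `ricciFlow_singularTime_le` (Topping Cor. 3.2.4) follows from `ricciFlow_scalarCurvature_lowerBound`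
  (Topping Thm. 3.2.1) (`ricciFlow_singularTime_le_of_scalarCurvature_lowerBound`,
  `RicciFlowScalarCurvatureHolds.lean`);
* `ricciFlow_preserves_positiveIsotropicCurvature` (Hamilton 1997, Thm. B1.2, first sentence)
  follows from its second sentence `ricciFlow_preserves_twoSmallestEigenvaluesSum_ge`
  (`RicciFlowPICProofs.lean`);
* `ricciFlow_uniqueness` (Hamilton 1982, Thm. 5.1) is reduced to the two parabolic inputs of the
  DeTurck argument (Andrews–Hopper 2011, §5.4.2, Step 6), taken as hypotheses
  (`ricciFlow_uniqueness_of_deTurck`, `RicciDeTurckReduction.lean`; the continuation step is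
  `RicciFlowUniqueness.lean`). [Amended 2026-08-15: an intermediate named fact
  `ricciFlow_local_uniqueness`, equivalent to `ricciFlow_uniqueness`, was merged back into it
  under D-0026, so the stages below take `ricciFlow_uniqueness` itself.]

The doubly primed stages below thread these reductions; their hypotheses — short-time existence
(Hamilton 1982, Thm. 4.2), uniqueness (Hamilton 1982, Thm. 5.1), Topping's Thm. 3.2.1,
curvature blow-up (Topping Thm. 5.3.1), Hamilton's Thm. B1.2 (second sentence), Chen–Zhu's
Lemma 2.1, and for the second stage Chen–Zhu's Thm. 4.1 and Perelman's no local collapsing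
theorem I — are the named facts currently standing between the vendored layers and the state at
the first singular time where the surgery of Chen–Zhu 2006, §5 begins. -/

/-- **First stage of Hamilton's programme, hypotheses as of 2026-08-15** (Chen–Zhu 2006, §4,
p. 19; Hamilton 1997, pp. 3–4): as `hamilton_programme_firstStage'`, with the singular-time bound
from Topping's Thm. 3.2.1
(`ricciFlow_singularTime_le_of_scalarCurvature_lowerBound`) and the preservation of PIC from
Hamilton's Thm. B1.2, second sentence
(`ricciFlow_preserves_positiveIsotropicCurvature_of_twoSmallestEigenvaluesSum_ge`).
[cite: ChenZhu2006, §4, p. 19] [cite: Hamilton1997, §1, pp. 3–4] -/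
theorem hamilton_programme_firstStage''
    (hST : ricciFlow_shortTime_existence.{0, 0, 0}) (hU : ricciFlow_uniqueness.{0, 0, 0})
    (h₂ : ricciFlow_scalarCurvature_lowerBound.{0, 0, 0})
    (h₄ : ricciFlow_curvature_blowup.{0, 0, 0})
    (h₅ : ricciFlow_preserves_twoSmallestEigenvaluesSum_ge.{0})
    (h₆ : hamilton_chenZhu_pinching.{0})
    (M : Type) [TopologicalSpace M] [T2Space M] [SecondCountableTopology M] [CompactSpace M]
    [Nonempty M] [ChartedSpace (EuclideanSpace ℝ (Fin 4)) M] [IsManifold (𝓡 4) ∞ M]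
    (g₀ : PseudoRiemannianMetric (𝓡 4) ∞ (EuclideanSpace ℝ (Fin 4))
      (TangentSpace (𝓡 4) : M → Type _))
    (hg₀ : g₀.IsRiemannian) (hpic : g₀.HasPositiveIsotropicCurvature) :
    ∃ (T : ℝ) (g : ℝ → PseudoRiemannianMetric (𝓡 4) ∞ (EuclideanSpace ℝ (Fin 4))
        (TangentSpace (𝓡 4) : M → Type _))
      (cov : ℝ → CovariantDerivative (𝓡 4) (EuclideanSpace ℝ (Fin 4))
        (TangentSpace (𝓡 4) : M → Type _)),
      IsMaximalRicciFlow g cov T ∧ g 0 = g₀ ∧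
      (∃ α : ℝ, 0 < α ∧ (∀ x : M, α ≤ g₀.scalarCurvatureWith (cov 0) x) ∧ T ≤ 2 / α) ∧
      (∀ C : ℝ, ∃ t₀ ∈ Ico 0 T, ∀ t ∈ Ico t₀ T, ¬ CurvatureBoundedBy (g t) (cov t) C) ∧
      (∀ t ∈ Ico 0 T, (g t).HasPositiveIsotropicCurvature) ∧
      ∃ ρ Λ P : ℝ, 0 < ρ ∧ 0 < Λ ∧ 0 < P ∧
        ∀ t ∈ Ico 0 T, ∀ (x : M) (e : Fin 4 → TangentSpace (𝓡 4) x),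
          (g t).IsOrthonormalFrame x e →
            Matrix.PinchedBy ((g t).blockA (cov t) x e) ((g t).blockB (cov t) x e)
                ((g t).blockC (cov t) x e) ρ Λ ∧
              Matrix.ImprovedPinchingAt ((g t).blockA (cov t) x e) ((g t).blockB (cov t) x e)
                ((g t).blockC (cov t) x e) ρ Λ P t :=
  hamilton_programme_firstStage' hST hU
    (ricciFlow_singularTime_le_of_scalarCurvature_lowerBound h₂) h₄
    (ricciFlow_preserves_positiveIsotropicCurvature_of_twoSmallestEigenvaluesSum_ge h₅) h₆ M g₀
    hg₀ hpic

/-- **Second stage of Hamilton's programme, hypotheses as of 2026-08-15** (Chen–Zhu 2006, §5,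
pp. 26–27): as `hamilton_programme_secondStage'`, with the reductions of
`hamilton_programme_firstStage''` and the a priori assumptions of the smooth solution now derived
from **Chen–Zhu's Theorem 4.1** (`chenZhu_canonicalNeighbourhoodTheorem`), Perelman's no local
collapsing theorem I, Lemma 2.1, the preservation of PIC and the PROVED space-time regularity of
the scalar curvature (`continuousOn_scalarCurvatureWith_family_holds`,
`CurvatureFamilyRegularity.lean`). [cite: ChenZhu2006, §5, pp. 26–27] [cite: Hamilton1997, §1, pp. 3–4] -/
theorem hamilton_programme_secondStage''
    (hST : ricciFlow_shortTime_existence.{0, 0, 0}) (hU : ricciFlow_uniqueness.{0, 0, 0})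
    (h₂ : ricciFlow_scalarCurvature_lowerBound.{0, 0, 0})
    (h₄ : ricciFlow_curvature_blowup.{0, 0, 0})
    (h₅ : ricciFlow_preserves_twoSmallestEigenvaluesSum_ge.{0})
    (h₆ : hamilton_chenZhu_pinching.{0})
    (h₇ : chenZhu_canonicalNeighbourhoodTheorem.{0}) (h₈ : perelman_noLocalCollapsing.{0, 0, 0}) :
    ∃ η : ℝ, 0 < η ∧ ∃ ε₀ : ℝ, 0 < ε₀ ∧ ∀ ε : ℝ, 0 < ε → ε ≤ ε₀ → ∃ C₁ C₂ : ℝ, 0 < C₁ ∧ 0 < C₂ ∧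
      ∀ (M : Type) [TopologicalSpace M] [T2Space M] [SecondCountableTopology M] [CompactSpace M]
        [ChartedSpace (EuclideanSpace ℝ (Fin 4)) M] [IsManifold (𝓡 4) ∞ M] [SimplyConnectedSpace M]
        [MeasurableSpace M] [BorelSpace M]
        (g₀ : PseudoRiemannianMetric (𝓡 4) ∞ (EuclideanSpace ℝ (Fin 4))
          (TangentSpace (𝓡 4) : M → Type _)),
        g₀.IsRiemannian → g₀.HasPositiveIsotropicCurvature →
        ∃ (c : ℝ) (hc : 0 < c) (T : ℝ)
          (g : ℝ → PseudoRiemannianMetric (𝓡 4) ∞ (EuclideanSpace ℝ (Fin 4))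
            (TangentSpace (𝓡 4) : M → Type _))
          (cov : ℝ → CovariantDerivative (𝓡 4) (EuclideanSpace ℝ (Fin 4))
            (TangentSpace (𝓡 4) : M → Type _)),
          IsMaximalRicciFlow g cov T ∧ 1 < T ∧ g 0 = g₀.constSmul c hc.ne' ∧
          (∀ C : ℝ, ∃ t₀ ∈ Ico 0 T, ∀ t ∈ Ico t₀ T, ¬ CurvatureBoundedBy (g t) (cov t) C) ∧
          (∀ t ∈ Ico 0 T, (g t).HasPositiveIsotropicCurvature) ∧
          (∃ ρ Λ P : ℝ, 0 < ρ ∧ 0 < Λ ∧ 0 < P ∧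
            ∀ t ∈ Ico 0 T, ∀ (x : M) (e : Fin 4 → TangentSpace (𝓡 4) x),
              (g t).IsOrthonormalFrame x e →
                Matrix.PinchedBy ((g t).blockA (cov t) x e) ((g t).blockB (cov t) x e)
                    ((g t).blockC (cov t) x e) ρ Λ ∧
                  Matrix.ImprovedPinchingAt ((g t).blockA (cov t) x e) ((g t).blockB (cov t) x e)
                    ((g t).blockC (cov t) x e) ρ Λ P t) ∧
          (∃ κ : ℝ, 0 < κ ∧ ∀ r₀ : ℝ, 0 < r₀ → r₀ < Real.sqrt T →
            IsKappaNoncollapsed g cov (Ico 0 T) κ r₀) ∧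
          ∃ r : ℝ → ℝ, (∀ t ∈ Ici (0 : ℝ), 0 < r t) ∧ AntitoneOn r (Ici 0) ∧
            ∀ t ∈ Ico 0 T, ∀ x : M,
              (r t)⁻¹ ^ 2 ≤ (g t).scalarCurvatureWith (cov t) x →
                HasCanonicalNeighbourhood g cov (Ico 0 T) x t ε C₁ C₂ η :=
  have hPIC := ricciFlow_preserves_positiveIsotropicCurvature_of_twoSmallestEigenvaluesSum_ge h₅
  hamilton_programme_secondStage' hST hU
    (ricciFlow_singularTime_le_of_scalarCurvature_lowerBound h₂) h₄ hPIC h₆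
    (chenZhu_aprioriAssumptions_smoothSolution_of_canonicalNeighbourhoodTheorem h₇ h₈ h₆ hPIC
      continuousOn_scalarCurvatureWith_family_holds) h₈

end Literature.Geometry.Riemannian

end
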